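import Summits.BirchSwinnertonDyer.BirchSwinnertonDyer.Theorems.CumulativeHeegnerLeopoldtCumulativeHeegnerInclusionAtThreeSpecialisationValues
import Summits.BirchSwinnertonDyer.BirchSwinnertonDyer.Theorems.CumulativeHeegnerLeopoldtCumulativeHeegnerInclusionAtThreeTadicPinOfControl
import HarnessLib

/-!
# Crux K1 `CumulativeHeegnerInclusionAtThree` (stmt-BirchSwinnertonDyer-24198), line `birth`, stub A (= crux 26896):
# the WEIGHTED index-currency transfer — error terms blowing up at the trivial character (`Λ[1/p, 1/T]` shape), pinned by
# non-vanishing of the characteristic power series at `T = 0`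

Lead seat bsd-line-chl-k1-p1 g5 (`--supports stmt-BirchSwinnertonDyer-24198`). Companion of `…SpecialisationValues` (p631301) and
`…SpecialisationValuesOff` (p633710). For residually REDUCIBLE `T` (our cell: `E[3]` reducible) the printed Kolyvagin-system bounds
carry an error term that blows up at the augmentation ideal: the divisibility lives in `Λ[1/p, 1/(γ − 1)]` (Castella–Grossi–Lee–Skinner
2022 Thm. 4.1.2; CGS 2023 §3). Specialisation by specialisation this is a bound `#(X ⧸ Q X) · (‖y‖^ν ‖L(y)‖)^{deg Q} ≤ p^{C deg Q}` at a
root `y` of `Q` — WEIGHTED by `‖y‖^ν`. Width seat -w2 landed the values form («weighted domination + the T-adic pin `ord_T g ≤ ord_T L`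
⟹ `p^μ L ∈ (g)`», p622618/p622856, and the pin from the control shape `HasCharValuationAt`, p623465). This file is the INDEX-currency
form: the weighted index bound, required only at `Q` prime to a fixed `a ≠ 0`, plus `g₀(0) ≠ 0` for the generator `g₀` of `char N`,
gives `∃ μ, p^μ · L ∈ (g₀ · R₀⟦T⟧)`.

* `exists_C_pow_mul_mem_span_of_weighted_card_quotSMulTop_le_off`.

HONEST FRAMING: pure algebra/analysis; the weighted index bound is a hypothesis (the research content of crux 26896 in the currency a
CGLS-type Kolyvagin-system argument produces); K1 = A + print stays open; BSD is not proved by any of this.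
-/


set_option linter.dupNamespace false
set_option autoImplicit false

noncomputable section

open scoped Classical Polynomial
open Literature.NumberTheory.EllipticCurves Literature.NumberTheory.EllipticCurves.IwasawaAlgebra
  Summit.BirchSwinnertonDyer.Rank1Residual.X11b.Halves
  Summit.BirchSwinnertonDyer.BirchSwinnertonDyer.Theorems.CumulativeHeegnerInclusionAtThreeUnrSeriesDomination
  Summit.BirchSwinnertonDyer.BirchSwinnertonDyer.Theorems.CumulativeHeegnerInclusionAtThreeUnrSeriesZeros
  Summit.BirchSwinnertonDyer.BirchSwinnertonDyer.Theorems.CongruentShaFreeCutBDPUpToPowerMapIdentity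
  Summit.BirchSwinnertonDyer.BirchSwinnertonDyer.Theorems.CumulativeHeegnerInclusionAtThreeSpecialisationValues

namespace Summit.BirchSwinnertonDyer.BirchSwinnertonDyer.Theorems.CumulativeHeegnerInclusionAtThreeSpecialisationValuesWeighted

variable {p : ℕ} [Fact p.Prime]


/-- **From WEIGHTED INDEX currency to stub A's currency.** Let `N` be a finitely generated torsion `Λ`-module with
`char N = (g₀)`, `g₀(0) ≠ 0` (the T-adic pin: `(T) ∤ char N`, i.e. `N_Γ` finite — on the crux's cell the control shape
`HasCharValuationAt`), `a ≠ 0`, `L ∈ R₀⟦T⟧`, `ν C ∈ ℕ`. If for every distinguished irreducible `Q` prime to `g₀` and to `a`, every root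
`y ∈ ℚ̄_p` of `Q` and `v = L(y)`: `#(N ⧸ Q N) · (‖y‖^ν · ‖v‖)^{deg Q} ≤ p^{C · deg Q}` (an index bound whose constant degenerates like
`‖y‖^{-ν}` at the trivial character), then `p^μ · L ∈ (g₀ · R₀⟦T⟧)` for some `μ` (index principle p628183 + values link p631301 ⟹
weighted domination at the algebraic points off the zeros of `g₀ a`; then -w2's
`exists_C_pow_mul_mem_span_of_weighted_norm_value_le_algebraic` with the pin `ord_T g₀ = 0`). -/
theorem exists_C_pow_mul_mem_span_of_weighted_card_quotSMulTop_le_off (N : Type*) [AddCommGroup N]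
    [Module (IwasawaAlgebra p) N] [Module.Finite (IwasawaAlgebra p) N]
    (hN : Module.IsTorsion (IwasawaAlgebra p) N) {g₀ : IwasawaAlgebra p}
    (hg₀ : Module.charIdeal (IwasawaAlgebra p) N = Ideal.span {g₀}) (hpin : PowerSeries.constantCoeff g₀ ≠ 0)
    {a : IwasawaAlgebra p} (ha : a ≠ 0) {L : UnrSeries p} {ν C : ℕ}
    (hKS : ∀ Q : ℤ_[p][X], Q.IsDistinguishedAt (IsLocalRing.maximalIdeal ℤ_[p]) → Irreducible Q →
      IsRelPrime g₀ (Q : IwasawaAlgebra p) → IsRelPrime a (Q : IwasawaAlgebra p) →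
      ∀ y : PadicAlgCl p, Polynomial.aeval y (Q.map (algebraMap ℤ_[p] ℚ_[p])) = 0 →
      ∀ v : ℂ_[p], L.HasValueAt (y : ℂ_[p]) v →
        (Nat.card (N ⧸ (Ideal.span {(Q : IwasawaAlgebra p)} • ⊤ : Submodule (IwasawaAlgebra p) N)) : ℝ) *
          (‖(y : ℂ_[p])‖ ^ ν * ‖v‖) ^ Q.natDegree ≤ (p : ℝ) ^ (C * Q.natDegree)) :
    ∃ μ : ℕ, PowerSeries.C (((p : ℕ) : unrIntegers p) ^ μ) * L ∈
      Ideal.span {PowerSeries.map (toUnr p) g₀} := by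
  have hp : p.Prime := Fact.out
  have hg0 : g₀ ≠ 0 := fun h => hpin (by rw [h, map_zero])
  set g : UnrSeries p := PowerSeries.map (toUnr p) g₀ with hgdef
  have hg : g ≠ 0 := map_toUnr_ne_zero hg0
  have hord : g.order ≤ L.order :=
    (PowerSeries.order_le 0 (by
      rw [PowerSeries.coeff_zero_eq_constantCoeff]
      exact Summit.BirchSwinnertonDyer.BirchSwinnertonDyer.Theorems.CumulativeHeegnerInclusionAtThreeTadicPinOfControl.constantCoeff_map_toUnr_ne_zero hpin)).trans
      bot_le
  -- the finitely many zeros of `g · a` in the open disc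
  have hga : PowerSeries.map (toUnr p) (g₀ * a) ≠ 0 := map_toUnr_ne_zero (mul_ne_zero hg0 ha)
  have hF : {z : ℂ_[p] | ‖z‖ < 1 ∧ UnrSeries.HasValueAt (PowerSeries.map (toUnr p) (g₀ * a)) z 0}.Finite :=
    finite_zeros hga
  obtain ⟨B, hB, hbd⟩ := exists_card_quotSMulTop_bounds_of_isRelPrime p N hN
  refine Summit.BirchSwinnertonDyer.BirchSwinnertonDyer.Theorems.CumulativeHeegnerInclusionAtThreeUnrSeriesTadicPin.exists_C_pow_mul_mem_span_of_weighted_norm_value_le_algebraic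
    hg hF (ν := ν) (C := (B : ℝ) * (p : ℝ) ^ C) ?_ hord
  intro y hyF hy1 u v hu hv
  have hy1' : ‖y‖ < 1 := by rwa [PadicComplex.norm_extends] at hy1
  obtain ⟨Q, hQ, hirr, hyQ⟩ := exists_isDistinguishedAt_irreducible_of_norm_lt_one hy1'
  have hd : 0 < Q.natDegree := natDegree_pos_of_irreducible p hQ hirr
  -- the value `w` of `a` at `y`; `u · w ≠ 0` since `y` is not a zero of `g₀ · a`
  obtain ⟨w, hw⟩ := exists_hasValueAt (PowerSeries.map (toUnr p) a) hy1
  have huw : u * w ≠ 0 := by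
    intro h0
    have hmul : UnrSeries.HasValueAt (PowerSeries.map (toUnr p) (g₀ * a)) (y : ℂ_[p]) (u * w) := by
      rw [map_mul]; exact hasValueAt_mul hy1 hu hw
    exact hyF ⟨hy1, h0 ▸ hmul⟩
  have hu0 : u ≠ 0 := left_ne_zero_of_mul huw
  have hw0 : w ≠ 0 := right_ne_zero_of_mul huw
  -- `Q ∤ g₀` and `Q ∤ a`
  have hndvd : ∀ {b : IwasawaAlgebra p} {z : ℂ_[p]},
      UnrSeries.HasValueAt (PowerSeries.map (toUnr p) b) (y : ℂ_[p]) z → z ≠ 0 →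
        IsRelPrime b (Q : IwasawaAlgebra p) := by
    intro b z hz hz0
    refine ((prime_coe_of_irreducible p hQ hirr).irreducible.isRelPrime_iff_not_dvd.mpr ?_).symm
    rintro ⟨k, hk⟩
    have hmem : b - ((0 : ℤ_[p][X]) : IwasawaAlgebra p) ∈ Ideal.span {(Q : IwasawaAlgebra p)} := by
      rw [Polynomial.coe_zero, sub_zero, hk]
      exact Ideal.mul_mem_right _ _ (Ideal.mem_span_singleton_self _)
    have h0 := value_eq_eval_of_sub_mem hQ hyQ hmem hz
    rw [Polynomial.map_zero, Polynomial.eval_zero] at h0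
    exact hz0 h0
  have hcop : IsRelPrime g₀ (Q : IwasawaAlgebra p) := hndvd hu hu0
  have hcopa : IsRelPrime a (Q : IwasawaAlgebra p) := hndvd hw hw0
  -- the three inputs and the combination, as in `…_of_card_quotSMulTop_le`
  have hlink := card_quotient_mul_norm_value_pow_eq_one hQ hirr hcop hyQ hu
  obtain ⟨-, h1, -⟩ := hbd Q hQ g₀ hg₀ hcop
  rw [hg₀] at h1
  have h2 := hKS Q hQ hirr hcop hcopa y hyQ v hv
  set d := Q.natDegree with hddef
  set c₁ : ℝ := ((Nat.card (IwasawaAlgebra p ⧸ (Ideal.span {(Q : IwasawaAlgebra p)} ⊔ Ideal.span {g₀})) : ℕ) : ℝ)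
    with hc₁
  set c₂ : ℝ := ((Nat.card (N ⧸ (Ideal.span {(Q : IwasawaAlgebra p)} • ⊤ : Submodule (IwasawaAlgebra p) N)) : ℕ) : ℝ)
    with hc₂
  have h1' : c₁ ≤ B * c₂ := by rw [hc₁, hc₂]; exact_mod_cast h1
  have hB1 : (1 : ℝ) ≤ B := by exact_mod_cast hB
  have hc₂0 : 0 ≤ c₂ := by rw [hc₂]; exact Nat.cast_nonneg _
  set t : ℝ := ‖(y : ℂ_[p])‖ ^ ν * ‖v‖ with ht
  have ht0 : 0 ≤ t := mul_nonneg (pow_nonneg (norm_nonneg _) _) (norm_nonneg _)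
  have hpow : t ^ d ≤ ((B : ℝ) * (p : ℝ) ^ C * ‖u‖) ^ d := by
    calc t ^ d = t ^ d * (c₁ * ‖u‖ ^ d) := by rw [hlink, mul_one]
      _ ≤ t ^ d * (B * c₂ * ‖u‖ ^ d) := by gcongr
      _ = B * (c₂ * t ^ d) * ‖u‖ ^ d := by ring
      _ ≤ B * (p : ℝ) ^ (C * d) * ‖u‖ ^ d := by gcongr
      _ ≤ (B : ℝ) ^ d * ((p : ℝ) ^ C) ^ d * ‖u‖ ^ d := by
          rw [← pow_mul]
          gcongr
          exact le_self_pow₀ hB1 hd.ne'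
      _ = ((B : ℝ) * (p : ℝ) ^ C * ‖u‖) ^ d := by ring
  exact (pow_le_pow_iff_left₀ ht0 (by positivity) hd.ne').mp hpow

end Summit.BirchSwinnertonDyer.BirchSwinnertonDyer.Theorems.CumulativeHeegnerInclusionAtThreeSpecialisationValuesWeighted

end
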